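import Literature.NumberTheory.Sieve.FGKMT2018Prop91PiIdentification
import HarnessLib

/-!
# Maynard 2016, Prop. 9.1 / FGKMT 2018, Thm 6 (7.12): the main term `Σ_r y_r²/φ_ω(r)` via Lemma 8.4

Source: J. Maynard, *Dense clusters of primes in subsets*, Compositio Math. 152 (2016), proof of
Proposition 9.1, (9.4) p. 20: Lemma 8.4 applied to `Σ_{r ∈ 𝒟_k} y_r²/φ_ω(r)` with `Ω_G = T_k²` gives
`(WB)^k 𝔖_{WB}(𝓛)/φ(WB)^k · (log R)^k (1 + O(k T_k² log log R/log R)) I_k(F)`; K. Ford, B. Green,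
S. Konyagin, J. Maynard, T. Tao, *Long gaps between primes*, JAMS 31 (2018), Thm 6 (7.12) pp. 21–22.

This file discharges the hypotheses of the tree's `MaynardDense.lemma84_all'_dec` (decoupled constants
`K₀ = k`, `K₁ = 2k − 1`) for the instance produced by `abs_sum_sieveWt_sub_rFoldSum_le` (moduli `W_j = idxMod`,
`g(p) = p − ω(p)`, `G = g_k²`, `Φ = ψ²`), bounds `L = 9 + Σ_{p∣M} log p/p ≤ 29 (log X)^{1/10}` for the moduli
`M ≤ W_j ⌈R⌉^k ≤ WBE⌈R⌉^k` that occur, and assembles, with `prefactor_mul_piRec_eq` («the singular series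
cancel») and `mainTerm_prefactor_eq`, the main-term statement in the frame of Prop. 6.1:
`#𝒜(x) φ_ω(W)/W · P² · Σ^{(k)} = (1 + O((log X)^{-1/10})) · mainTermA` (`prop91_mainTerm_frame`).
-/

open Finset Filter Real
open scoped Topology

namespace Literature.NumberTheory.Sieve.FGKMT2018

variable {k : ℕ}

/-! ### The arithmetic hypotheses of Lemma 8.4 for `W_j`, `g(p) = p − ω(p)` -/

/-- `g(p) = p − ω(p) > 0` for admissible `𝓛`. [cite: Maynard2016DenseClusters, proof of Prop. 9.1 (9.4) p. 20 (g = φ_ω)] -/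
theorem sub_omegaL_pos {L : Fin k → ℤ × ℤ} (hadm : FormsAdmissible L) {p : ℕ} (hp : p.Prime) :
    (0 : ℝ) < (p : ℝ) - omegaL L p := by
  have : ((omegaL L p : ℕ) : ℝ) < p := by exact_mod_cast ((formsAdmissible_iff_omegaL L).1 hadm).2 p hp
  linarith

/-- The deviation hypothesis with `K₁ = 2k − 1`: `|1 + g(p) − p| + k = |1 − ω(p)| + k ≤ 2k − 1` (`0 ≤ ω(p) ≤ k`,
`k ≥ 2`). [cite: Maynard2016DenseClusters, Lemma 8.4 (hypothesis g ∈ Ω₂(L)), proof of Prop. 9.1 p. 20] -/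
theorem abs_dev_omegaL_add_le (hk : 2 ≤ k) {L : Fin k → ℤ × ℤ} (hadm : FormsAdmissible L) {p : ℕ}
    (hp : p.Prime) : |1 + ((p : ℝ) - omegaL L p) - p| + (k : ℝ) ≤ 2 * (k : ℝ) - 1 := by
  have h1 : ((omegaL L p : ℕ) : ℝ) ≤ k := by exact_mod_cast omegaL_le_card_of_admissible hadm hp
  have hk' : (2 : ℝ) ≤ k := by exact_mod_cast hk
  rw [show (1 : ℝ) + ((p : ℝ) - omegaL L p) - p = 1 - omegaL L p by ring]
  rcases Nat.eq_zero_or_pos (omegaL L p) with h0 | hpos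
  · rw [h0, Nat.cast_zero, sub_zero, abs_one]
    linarith
  · have : (1 : ℝ) ≤ omegaL L p := by exact_mod_cast hpos
    rw [abs_of_nonpos (by linarith)]
    linarith

/-- The primes `p ≤ 2K₀²` (`K₀ = k`) divide every `W_j`. [cite: Maynard2016DenseClusters, Lemma 8.4 (hypotheses) p. 16] -/
theorem dvd_idxMod_of_real_le (L : Fin k → ℤ × ℤ) (B : ℕ) (R : ℝ) (i : Fin k) {p : ℕ} (hp : p.Prime)
    (h : (p : ℝ) ≤ 2 * (k : ℝ) ^ 2) : p ∣ idxMod L B R i := by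
  have : p ≤ 2 * k ^ 2 := by exact_mod_cast h
  exact dvd_idxMod_of_le L B R i hp this

/-! ### The analytic constants: `Ω_G/I_G ≪ T_k²` -/

/-- `G_s/I_G ≤ 3 T_k²` for `G = g_k²`: `2(1 + 30/U_k + T_k) ≤ 3 (k log k)² γ_k` (`k ≥ 2^18`; `γ_k T_k ≥ 4999/5000`,
`30√k ≤ k/12`, `log k ≥ 12`). [cite: Maynard2016DenseClusters, proof of Prop. 9.1 p. 20 («taking Ω_G = T_k²»), Lemma 8.6 p. 18] -/
theorem two_mul_Gs_le (hk : 262144 ≤ k) :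
    2 * (1 + 30 / MaynardDense.U k + MaynardDense.T k) ≤
      3 * ((k : ℝ) * Real.log k) ^ 2 * MaynardDense.gam k := by
  have hk2 : 2 ≤ k := by omega
  have hkr : (262144 : ℝ) ≤ k := by exact_mod_cast hk
  have hk0 : (0 : ℝ) < k := by linarith
  have hlog : 12 ≤ Real.log k := MaynardDense.twelve_le_log hk
  have hT : MaynardDense.T k = k * Real.log k := rfl
  have hTpos : 0 < MaynardDense.T k := MaynardDense.T_pos hk2
  have hsqrt : (512 : ℝ) ≤ Real.sqrt k := by
    rw [show (512 : ℝ) = Real.sqrt (512 ^ 2) by rw [Real.sqrt_sq (by norm_num)]]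
    exact Real.sqrt_le_sqrt (by norm_num; linarith)
  have hU : 30 / MaynardDense.U k = 30 * Real.sqrt k := by
    rw [MaynardDense.U_eq_inv_sqrt, div_inv_eq_mul]
  have hsqk : Real.sqrt k ≤ k / 512 := by
    rw [le_div_iff₀ (by norm_num : (0 : ℝ) < 512)]
    have h := Real.mul_self_sqrt hk0.le
    nlinarith [Real.sqrt_nonneg (k : ℝ)]
  have h1 : 2 * (1 + 30 / MaynardDense.U k + MaynardDense.T k) ≤ (7 / 3) * MaynardDense.T k := by
    rw [hU, hT]
    nlinarith
  have h2 : (7 / 3 : ℝ) * MaynardDense.T k ≤ 3 * ((k : ℝ) * Real.log k) ^ 2 * MaynardDense.gam k := by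
    have hg := MaynardDense.gam_mul_T_ge hk
    rw [← hT]
    nlinarith
  exact h1.trans h2

/-! ### The size hypothesis: `L = 9 + Σ_{p ∣ M} log p/p ≤ 29 (log X)^{1/10}` -/

/-- `log 4 ≤ 2` and `log 52 ≤ 4`. [folklore] -/
private theorem log_four_le_two_and_log_52_le_four : Real.log 4 ≤ 2 ∧ Real.log 52 ≤ 4 := by
  have h := Real.exp_one_gt_d9
  have h0 := Real.exp_pos (1 : ℝ)
  have he2 : Real.exp 2 = Real.exp 1 * Real.exp 1 := by rw [← Real.exp_add]; norm_num
  have h2 : (7389 : ℝ) / 1000 ≤ Real.exp 2 := by rw [he2]; nlinarith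
  constructor
  · rw [Real.log_le_iff_le_exp (by norm_num)]
    linarith
  · rw [Real.log_le_iff_le_exp (by norm_num)]
    have : Real.exp 4 = Real.exp 2 * Real.exp 2 := by rw [← Real.exp_add]; norm_num
    rw [this]; nlinarith [Real.exp_pos (2 : ℝ)]

/-- **The `L ≪ log log R` hypothesis of Lemma 8.4, effective form**: if `log X ≥ 1`, `k² ≤ 2(log X)^{2/5}`,
`B ≤ 2X`, `log E ≤ 20 k² log X`, `W_j ≤ WBE` for all `j`, and `1 ≤ R ≤ X`, then for every modulus `M ≠ 0`
with `M ≤ W_j ⌈R⌉^k` one has `9 + Σ_{p ∣ M} log p/p ≤ 29 (log X)^{1/10}` (take `T = 52 (log X)^{13/10}` in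
`Σ_{p∣M} log p/p ≤ log T + log 4 + log M/T`, `log M ≤ 26 k² log X ≤ 52 (log X)^{7/5}`).
[cite: Maynard2016DenseClusters, Lemma 8.4 (L ≪ log log R) p. 16, proof of Lemma 8.4 p. 17; MaynardAnnals2015, proof of Lemma 6.3 p. 14] -/
theorem lambda84_le (hk : 2 ≤ k) {L : Fin k → ℤ × ℤ} {B : ℕ} (hB0 : B ≠ 0) {R X : ℝ} {E : ℕ}
    (hX : 1 ≤ X) (hlX : 1 ≤ Real.log X) (hkX : (k : ℝ) ^ 2 ≤ 2 * Real.log X ^ ((2 : ℝ) / 5))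
    (hBX : (B : ℝ) ≤ 2 * X) (hE1 : 1 ≤ E) (hlogE : Real.log E ≤ 20 * (k : ℝ) ^ 2 * Real.log X)
    (hWi : ∀ i, idxMod L B R i ≤ wCut k B * B * E) (hR1 : 1 ≤ R) (hRX : R ≤ X) (i : Fin k) {M : ℕ}
    (hM : M ≠ 0) (hMle : (M : ℝ) ≤ (idxMod L B R i : ℝ) * (⌈R⌉₊ : ℝ) ^ k) :
    9 + ∑ p ∈ M.primeFactors, Real.log p / p ≤ 29 * Real.log X ^ ((1 : ℝ) / 10) := by
  obtain ⟨hlog4, hlog52⟩ := log_four_le_two_and_log_52_le_four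
  set lX := Real.log X with hlXdef
  have hlX0 : 0 < lX := by linarith
  set u := lX ^ ((1 : ℝ) / 10) with hu
  have hu1 : 1 ≤ u := Real.one_le_rpow hlX (by norm_num)
  have hk2r : (2 : ℝ) ≤ k := by exact_mod_cast hk
  have hk4 : (4 : ℝ) ≤ (k : ℝ) ^ 2 := by nlinarith
  have hX0 : 0 < X := by linarith
  have hlog2X : Real.log (2 * X) ≤ 2 * lX := by
    rw [Real.log_mul (by norm_num) hX0.ne', hlXdef]
    have : Real.log 2 ≤ 1 := by have := Real.log_two_lt_d9; linarith
    linarith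
  -- the four factors of `W B E ⌈R⌉^k`
  have hW1 : (1 : ℝ) ≤ (wCut k B : ℝ) := by exact_mod_cast Nat.one_le_iff_ne_zero.2 (wCut_ne_zero k B)
  have hB1 : (1 : ℝ) ≤ (B : ℝ) := by exact_mod_cast Nat.one_le_iff_ne_zero.2 hB0
  have hE1r : (1 : ℝ) ≤ (E : ℝ) := by exact_mod_cast hE1
  have hC1 : (1 : ℝ) ≤ (⌈R⌉₊ : ℝ) := by exact_mod_cast Nat.one_le_iff_ne_zero.2 (Nat.ceil_pos.2 (by linarith)).ne'
  have hlogW : Real.log (wCut k B : ℝ) ≤ 4 * (k : ℝ) ^ 2 * lX := by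
    have h1 : (wCut k B : ℝ) ≤ (4 : ℝ) ^ (2 * k ^ 2) := by exact_mod_cast wCut_le_four_pow k B
    calc Real.log (wCut k B : ℝ) ≤ Real.log ((4 : ℝ) ^ (2 * k ^ 2)) := Real.log_le_log (by linarith) h1
      _ = (2 * k ^ 2 : ℕ) * Real.log 4 := by rw [Real.log_pow]
      _ ≤ (2 * k ^ 2 : ℕ) * 2 := mul_le_mul_of_nonneg_left hlog4 (Nat.cast_nonneg _)
      _ = 4 * (k : ℝ) ^ 2 * 1 := by push_cast; ring
      _ ≤ 4 * (k : ℝ) ^ 2 * lX := mul_le_mul_of_nonneg_left hlX (by positivity)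
  have hlogB : Real.log (B : ℝ) ≤ (k : ℝ) ^ 2 * lX := by
    calc Real.log (B : ℝ) ≤ Real.log (2 * X) := Real.log_le_log (by linarith) hBX
      _ ≤ 2 * lX := hlog2X
      _ ≤ (k : ℝ) ^ 2 * lX := mul_le_mul_of_nonneg_right (by linarith) hlX0.le
  have hlogC : (k : ℝ) * Real.log (⌈R⌉₊ : ℝ) ≤ (k : ℝ) ^ 2 * lX := by
    have hc : (⌈R⌉₊ : ℝ) ≤ 2 * X := by
      have := Nat.ceil_lt_add_one (by linarith : (0 : ℝ) ≤ R)
      linarith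
    have h1 : Real.log (⌈R⌉₊ : ℝ) ≤ 2 * lX := (Real.log_le_log (by linarith) hc).trans hlog2X
    calc (k : ℝ) * Real.log (⌈R⌉₊ : ℝ) ≤ (k : ℝ) * (2 * lX) := mul_le_mul_of_nonneg_left h1 (by linarith)
      _ = 2 * (k : ℝ) * lX := by ring
      _ ≤ (k : ℝ) ^ 2 * lX := mul_le_mul_of_nonneg_right (by nlinarith) hlX0.le
  -- `log M ≤ 26 k² log X ≤ 52 (log X)^{7/5}`
  have hM0 : (0 : ℝ) < M := by exact_mod_cast Nat.pos_of_ne_zero hM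
  have hMle' : (M : ℝ) ≤ (wCut k B : ℝ) * B * E * (⌈R⌉₊ : ℝ) ^ k := by
    have h1 : (idxMod L B R i : ℝ) ≤ (wCut k B : ℝ) * B * E := by exact_mod_cast hWi i
    exact hMle.trans (mul_le_mul_of_nonneg_right h1 (by positivity))
  have hlogM : Real.log M ≤ 26 * (k : ℝ) ^ 2 * lX := by
    have hpos : (0 : ℝ) < (wCut k B : ℝ) * B * E * (⌈R⌉₊ : ℝ) ^ k := by positivity
    calc Real.log M ≤ Real.log ((wCut k B : ℝ) * B * E * (⌈R⌉₊ : ℝ) ^ k) := Real.log_le_log hM0 hMle'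
      _ = Real.log (wCut k B : ℝ) + Real.log B + Real.log E + k * Real.log (⌈R⌉₊ : ℝ) := by
          rw [Real.log_mul (by positivity) (by positivity), Real.log_mul (by positivity) (by positivity),
            Real.log_mul (by positivity) (by positivity), Real.log_pow]
      _ ≤ 4 * (k : ℝ) ^ 2 * lX + (k : ℝ) ^ 2 * lX + 20 * (k : ℝ) ^ 2 * lX + (k : ℝ) ^ 2 * lX := by
          linarith
      _ = 26 * (k : ℝ) ^ 2 * lX := by ring
  have h75 : lX ^ ((2 : ℝ) / 5) * lX = lX ^ ((7 : ℝ) / 5) := by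
    rw [← Real.rpow_add_one hlX0.ne']; norm_num
  have hlogM' : Real.log M ≤ 52 * lX ^ ((7 : ℝ) / 5) := by
    calc Real.log M ≤ 26 * (k : ℝ) ^ 2 * lX := hlogM
      _ ≤ 26 * (2 * lX ^ ((2 : ℝ) / 5)) * lX :=
          mul_le_mul_of_nonneg_right (mul_le_mul_of_nonneg_left hkX (by norm_num)) hlX0.le
      _ = 52 * lX ^ ((7 : ℝ) / 5) := by rw [← h75]; ring
  -- `T = 52 (log X)^{13/10}`
  set T := 52 * lX ^ ((13 : ℝ) / 10) with hT
  have hT1 : 1 ≤ lX ^ ((13 : ℝ) / 10) := Real.one_le_rpow hlX (by norm_num)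
  have hTpos : 0 < T := by rw [hT]; positivity
  have hT3 : 3 ≤ T := by rw [hT]; linarith
  have hsum := sum_primeFactors_log_div_le hM hT3
  have hdiv : Real.log M / T ≤ u := by
    rw [div_le_iff₀ hTpos, hu, hT]
    have : lX ^ ((1 : ℝ) / 10) * (52 * lX ^ ((13 : ℝ) / 10)) = 52 * lX ^ ((7 : ℝ) / 5) := by
      rw [mul_left_comm, ← Real.rpow_add hlX0]; norm_num
    rw [this]; exact hlogM'
  have hlogT : Real.log T ≤ 4 + 13 * u := by
    rw [hT, Real.log_mul (by norm_num) (by positivity), Real.log_rpow hlX0]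
    have h1 : Real.log lX ≤ lX ^ ((1 : ℝ) / 10) / ((1 : ℝ) / 10) := Real.log_le_rpow_div hlX0.le (by norm_num)
    rw [hu]
    have : (13 : ℝ) / 10 * Real.log lX ≤ 13 * lX ^ ((1 : ℝ) / 10) := by
      have := mul_le_mul_of_nonneg_left h1 (by norm_num : (0 : ℝ) ≤ 13 / 10)
      linarith
    linarith
  linarith

/-! ### Growth bookkeeping in the ranges of Proposition 6.1 -/

/-- `log 2 ≤ 1`, `exp 2 ≤ 8`. [folklore] -/
private theorem log_two_le_one_and_exp_two_le : Real.log 2 ≤ 1 ∧ Real.exp 2 ≤ 8 := by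
  constructor
  · have := Real.log_two_lt_d9; linarith
  · have h := Real.exp_one_lt_d9
    have : Real.exp 2 = Real.exp 1 * Real.exp 1 := by rw [← Real.exp_add]; norm_num
    rw [this]; nlinarith [Real.exp_pos (1 : ℝ)]

/-- In the ranges of Prop. 6.1 (`k ≤ (log x)^{1/5}`, `x/2 ≤ X`, `X^{1/30} ≤ R`), eventually in `x`:
`X ≥ 1`, `log X ≥ 1`, `(log X)^{1/10} ≥ K₀`, `k² ≤ 2 (log X)^{2/5}`, `k³ log² k ≤ 8 (log X)^{4/5}`,
`log X ≤ 30 log R`, `R ≥ 2`. [cite: Maynard2016DenseClusters, proof of Prop. 9.1 p. 20 (k T_k² log log R/log R = o(1) for k ≤ (log x)^{1/5}); FordGreenKonyaginMaynardTao2018, Thm 6 p. 21 (ranges)] -/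
theorem eventually_prop91_main_aux (K₀ : ℝ) :
    ∀ᶠ x : ℕ in atTop, ∀ k : ℕ, (k : ℝ) ≤ Real.log x ^ ((1 : ℝ) / 5) → ∀ X R : ℝ,
      (x : ℝ) / 2 ≤ X → X ^ ((1 : ℝ) / 30) ≤ R →
        1 ≤ X ∧ 1 ≤ Real.log X ∧ K₀ ≤ Real.log X ^ ((1 : ℝ) / 10) ∧
          (k : ℝ) ^ 2 ≤ 2 * Real.log X ^ ((2 : ℝ) / 5) ∧
          (k : ℝ) ^ 3 * Real.log k ^ 2 ≤ 8 * Real.log X ^ ((4 : ℝ) / 5) ∧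
          Real.log X ≤ 30 * Real.log R ∧ 2 ≤ R := by
  obtain ⟨hlog2, hexp2⟩ := log_two_le_one_and_exp_two_le
  have hP : Tendsto (fun x : ℕ => ((x : ℝ) / 2) ^ ((1 : ℝ) / 30)) atTop atTop :=
    (tendsto_rpow_atTop (by norm_num)).comp (tendsto_natCast_atTop_atTop.atTop_div_const (by norm_num))
  have hL : Tendsto (fun x : ℕ => (Real.log x / 2) ^ ((1 : ℝ) / 10)) atTop atTop :=
    (tendsto_rpow_atTop (by norm_num)).comp
      ((Real.tendsto_log_atTop.comp tendsto_natCast_atTop_atTop).atTop_div_const (by norm_num))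
  filter_upwards [hP.eventually_ge_atTop 2, eventually_ge_atTop 16, hL.eventually_ge_atTop K₀]
    with x hx2 hx16 hK k hk X R hX hR
  have hx16' : (16 : ℝ) ≤ x := by exact_mod_cast hx16
  have hx0 : (0 : ℝ) < x := by linarith
  set ℓ := Real.log (x : ℝ) with hℓ
  have hℓ2 : 2 ≤ ℓ := by
    rw [hℓ, Real.le_log_iff_exp_le hx0]; linarith
  have hℓ0 : 0 < ℓ := by linarith
  have hX1 : 1 ≤ X := by linarith
  have hX0 : 0 < X := by linarith
  have hlogX : ℓ - Real.log 2 ≤ Real.log X := by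
    rw [hℓ, ← Real.log_div hx0.ne' two_ne_zero]; exact Real.log_le_log (by positivity) hX
  have hA : ℓ ≤ 2 * Real.log X := by linarith
  have hlX1 : 1 ≤ Real.log X := by linarith
  have hlX0 : 0 < Real.log X := by linarith
  have h2r : ∀ r : ℝ, r ≤ 1 → (2 : ℝ) ^ r ≤ 2 := fun r hr => Real.rpow_le_self_of_one_le (by norm_num) hr
  refine ⟨hX1, hlX1, ?_, ?_, ?_, ?_, ?_⟩
  · exact hK.trans (Real.rpow_le_rpow (by positivity) (by linarith) (by norm_num))
  · have hk0 : (0 : ℝ) ≤ k := Nat.cast_nonneg k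
    have h := pow_le_pow_left₀ hk0 hk 2
    rw [← Real.rpow_natCast (ℓ ^ ((1 : ℝ) / 5)) 2, ← Real.rpow_mul hℓ0.le] at h
    norm_num at h
    calc (k : ℝ) ^ 2 ≤ ℓ ^ ((2 : ℝ) / 5) := h
      _ ≤ (2 * Real.log X) ^ ((2 : ℝ) / 5) := Real.rpow_le_rpow hℓ0.le hA (by norm_num)
      _ = (2 : ℝ) ^ ((2 : ℝ) / 5) * Real.log X ^ ((2 : ℝ) / 5) := Real.mul_rpow (by norm_num) hlX0.le
      _ ≤ 2 * Real.log X ^ ((2 : ℝ) / 5) :=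
          mul_le_mul_of_nonneg_right (h2r _ (by norm_num)) (by positivity)
  · rcases Nat.eq_zero_or_pos k with h0 | hkpos
    · subst h0; simp; positivity
    · have hk1 : (1 : ℝ) ≤ k := by exact_mod_cast hkpos
      have hk0 : (0 : ℝ) < k := by linarith
      have hlogk : Real.log k ≤ 2 * ℓ ^ ((1 : ℝ) / 10) := by
        calc Real.log k ≤ Real.log (ℓ ^ ((1 : ℝ) / 5)) := Real.log_le_log hk0 hk
          _ = (1 : ℝ) / 5 * Real.log ℓ := Real.log_rpow hℓ0 _
          _ ≤ (1 : ℝ) / 5 * (ℓ ^ ((1 : ℝ) / 10) / ((1 : ℝ) / 10)) :=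
              mul_le_mul_of_nonneg_left (Real.log_le_rpow_div hℓ0.le (by norm_num)) (by norm_num)
          _ = 2 * ℓ ^ ((1 : ℝ) / 10) := by ring
      have hlogk0 : 0 ≤ Real.log k := Real.log_nonneg hk1
      have hk3 : (k : ℝ) ^ 3 ≤ ℓ ^ ((3 : ℝ) / 5) := by
        have h := pow_le_pow_left₀ hk0.le hk 3
        rw [← Real.rpow_natCast (ℓ ^ ((1 : ℝ) / 5)) 3, ← Real.rpow_mul hℓ0.le] at h
        norm_num at h; exact h
      have hsq : Real.log k ^ 2 ≤ 4 * ℓ ^ ((1 : ℝ) / 5) := by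
        have h := pow_le_pow_left₀ hlogk0 hlogk 2
        rw [mul_pow, ← Real.rpow_natCast (ℓ ^ ((1 : ℝ) / 10)) 2, ← Real.rpow_mul hℓ0.le] at h
        norm_num at h; linarith
      have h45 : ℓ ^ ((3 : ℝ) / 5) * ℓ ^ ((1 : ℝ) / 5) = ℓ ^ ((4 : ℝ) / 5) := by
        rw [← Real.rpow_add hℓ0]; norm_num
      calc (k : ℝ) ^ 3 * Real.log k ^ 2 ≤ ℓ ^ ((3 : ℝ) / 5) * (4 * ℓ ^ ((1 : ℝ) / 5)) :=
            mul_le_mul hk3 hsq (by positivity) (by positivity)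
        _ = 4 * ℓ ^ ((4 : ℝ) / 5) := by rw [mul_left_comm, h45]
        _ ≤ 4 * (2 * Real.log X) ^ ((4 : ℝ) / 5) :=
            mul_le_mul_of_nonneg_left (Real.rpow_le_rpow hℓ0.le hA (by norm_num)) (by norm_num)
        _ = 4 * ((2 : ℝ) ^ ((4 : ℝ) / 5) * Real.log X ^ ((4 : ℝ) / 5)) := by
            rw [Real.mul_rpow (by norm_num) hlX0.le]
        _ ≤ 4 * (2 * Real.log X ^ ((4 : ℝ) / 5)) :=
            mul_le_mul_of_nonneg_left (mul_le_mul_of_nonneg_right (h2r _ (by norm_num)) (by positivity))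
              (by norm_num)
        _ = 8 * Real.log X ^ ((4 : ℝ) / 5) := by ring
  · have hXr : 0 < X ^ ((1 : ℝ) / 30) := Real.rpow_pos_of_pos hX0 _
    have h := Real.log_le_log hXr hR
    rw [Real.log_rpow hX0] at h
    linarith
  · have h1 : ((x : ℝ) / 2) ^ ((1 : ℝ) / 30) ≤ X ^ ((1 : ℝ) / 30) :=
      Real.rpow_le_rpow (by positivity) hX (by norm_num)
    linarith

/-! ### The main term (9.4) in the frame of Proposition 6.1 -/

set_option maxHeartbeats 1600000 in
/-- **Maynard's (9.4) / the main term of FGKMT (7.12)**: in the ranges of Prop. 6.1, for `k ≥ 2^18`,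
`|#𝒜(x) φ_ω(W)/W · P² · Σ^{(k)}(W_j; g; ψ², g_k²) − mainTermA| ≤ K (log X)^{-1/10} mainTermA`, where
`P = (WB)^k 𝔖_{WB}(𝓛)/φ(WB)^k`, `Σ^{(k)}` is the `k`-fold sum `Σ_r y_r²/φ_ω(r)` in the form produced by
`abs_sum_sieveWt_sub_rFoldSum_le`, and `mainTermA = (B/φ(B))^k 𝔖_B(𝓛) #𝒜(x) (log R)^k I_k(F)`: Lemma 8.4
(decoupled constants `K₀ = k`, `K₁ = 2k − 1`, `L ≤ 29 (log X)^{1/10}`, `Ω_G/I_G ≤ 3T_k²`) gives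
`Σ^{(k)} = Π (log R)^k (I_k(F) + O(k T_k² L/log R · γ^k))` with `γ^k ≤ 2 I_k(F)`, and `P·Π = excProd ∈ [1, 1 + 1/log X]`
(«the singular series cancel»), `φ_ω(W)/W · P = (B/φ(B))^k 𝔖_B`.
[cite: Maynard2016DenseClusters, proof of Prop. 9.1 (9.4) p. 20, Lemma 8.4 p. 16, Lemma 8.6 p. 18; FordGreenKonyaginMaynardTao2018, Thm 6 (7.12) pp. 21–22] -/
theorem prop91_mainTerm_frame :
    ∃ (C : ℕ) (K : ℝ), 0 < K ∧ Prop61Frame C fun B k L X R =>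
      |(#(dyadZ X) : ℝ) * phiOmega L (wCut k B) / (wCut k B : ℝ) *
          ((((wCut k B * B : ℕ) : ℝ) ^ k / (Nat.totient (wCut k B * B) : ℝ) ^ k *
              singSeriesExcl L (wCut k B * B)) ^ 2 *
            MaynardDense.rFoldSum k (idxMod L B R) (fun p => (p : ℝ) - omegaL L p)
              (fun x => MaynardDense.psi x ^ 2) (fun t => MaynardDense.profExt k t ^ 2) R 0) -
        mainTermA L B X R (MaynardDense.IF k)| ≤
      K / Real.log X ^ ((1 : ℝ) / 10) * mainTermA L B X R (MaynardDense.IF k) := by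
  obtain ⟨C84, hC0, h84⟩ := MaynardDense.lemma84_all'_dec
  set CE : ℝ := 20880 * C84 with hCE
  have hCE0 : 0 ≤ CE := by positivity
  refine ⟨262144, 488 * CE + 1, by positivity, ?_⟩
  have hfr := prop91_excProd_frame
  unfold Prop61Frame at hfr ⊢
  filter_upwards [hfr, eventually_prop91_main_aux (CE + 1)] with x hxE hx B hB hBx k L X R hCk hk hadm
    hnd hcoef hX1 hX2 hR1 hR2
  obtain ⟨E, hE1, hE, hlogE, -, hPiE, hex1, hex2⟩ :=
    hxE B hB hBx k L X R (le_trans (by norm_num) hCk) hk hadm hnd hcoef hX1 hX2 hR1 hR2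
  obtain ⟨hXone, hlX1, hKbig, hk2X, hk3X, hlogXR, hR2'⟩ := hx k hk X R hX1 hR1
  have hk2 : 2 ≤ k := le_trans (by norm_num) hCk
  have hk0 : (0 : ℝ) < k := by exact_mod_cast (show 0 < k by omega)
  have hB0 : B ≠ 0 := hB.elim (fun h => by rw [h]; exact one_ne_zero) fun h => h.ne_zero
  have hlX0 : 0 < Real.log X := by linarith
  have hlogR : 0 < Real.log R := Real.log_pos (by linarith)
  -- abbreviations
  set W := wCut k B with hW
  set A : ℕ → ℝ := fun p => (p : ℝ) - omegaL L p with hA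
  set P : ℝ := ((W * B : ℕ) : ℝ) ^ k / (Nat.totient (W * B) : ℝ) ^ k * singSeriesExcl L (W * B) with hP
  set Pi : ℝ := MaynardDense.piRec k (idxMod L B R) A with hPi
  set S : ℝ := MaynardDense.rFoldSum k (idxMod L B R) A (fun x => MaynardDense.psi x ^ 2)
    (fun t => MaynardDense.profExt k t ^ 2) R 0 with hS
  set c : ℝ := (#(dyadZ X) : ℝ) * phiOmega L W / (W : ℝ) with hc
  set LI : ℝ := Real.log R ^ k * MaynardDense.IF k with hLI
  set ex : ℝ := excProd L (W * B) ⌊R⌋₊ E with hex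
  set u : ℝ := Real.log X ^ ((1 : ℝ) / 10) with hu
  -- positivity
  have hu1 : 1 ≤ u := Real.one_le_rpow hlX1 (by norm_num)
  have hu0 : 0 < u := by linarith
  have hulX : u ≤ Real.log X := Real.rpow_le_self_of_one_le hlX1 (by norm_num)
  have hIF : 0 < MaynardDense.IF k := MaynardDense.orthantI_F_pos hCk
  have hLI0 : 0 ≤ LI := by positivity
  have hSpos : 0 < singSeriesExcl L (W * B) := singSeriesExcl_pos_of_nondegenerate hadm hnd _
  have hφpos : (0 : ℝ) < (Nat.totient (W * B) : ℝ) := by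
    exact_mod_cast Nat.totient_pos.2 (Nat.pos_of_ne_zero (mul_ne_zero (wCut_ne_zero k B) hB0))
  have hWB0 : (0 : ℝ) < ((W * B : ℕ) : ℝ) := by
    exact_mod_cast Nat.pos_of_ne_zero (mul_ne_zero (wCut_ne_zero k B) hB0)
  have hP0 : 0 < P := by rw [hP]; positivity
  have hφω : 0 < phiOmega L W :=
    phiOmega_pos_of_forall_lt L fun p hp =>
      ((formsAdmissible_iff_omegaL L).1 hadm).2 p (Nat.prime_of_mem_primeFactors hp)
  have hc0 : 0 ≤ c := by positivity
  -- the main term is `c · P · (log R)^k I_k(F)`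
  have hmain : mainTermA L B X R (MaynardDense.IF k) = c * P * LI := by
    rw [mainTermA, ← mainTerm_prefactor_eq hadm hnd B, hc, hLI]; ring
  -- Lemma 8.4
  obtain ⟨hG1, hG2, hG3, hG4, hG5, hG6, hG7⟩ := MaynardDense.lemma84_hypG_profExt_sq hk2
  obtain ⟨hΦ1, hΦ2, hΦ3⟩ := MaynardDense.lemma84_hypPhi_psi_sq
  set Λ : ℝ := 29 * u with hΛ
  set Gs : ℝ := 2 * (1 + 30 / MaynardDense.U k + MaynardDense.T k) with hGs
  have hWi : ∀ i, idxMod L B R i ≤ W * B * E := fun i =>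
    idxMod_le_mul_exceptional hadm B R i (by omega) hE
  have hBX : (B : ℝ) ≤ 2 * X := by
    have : (B : ℝ) ≤ x := by exact_mod_cast hBx
    linarith
  have hRX : R ≤ X := hR2.trans (Real.rpow_le_self_of_one_le hXone (by norm_num))
  have hΛhyp : ∀ i, ∀ M : ℕ, M ≠ 0 → (M : ℝ) ≤ (idxMod L B R i : ℝ) * (⌈R⌉₊ : ℝ) ^ k →
      9 + ∑ p ∈ M.primeFactors, Real.log p / p ≤ Λ := fun i M hM hMle =>
    lambda84_le hk2 hB0 hXone hlX1 hk2X hBX hE1 hlogE hWi (by linarith) hRX i hM hMle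
  -- `k ε ≤ CE/(log X)^{1/10} ≤ 1`
  have hGsb : Gs ≤ 3 * ((k : ℝ) * Real.log k) ^ 2 * MaynardDense.gam k := two_mul_Gs_le hCk
  have hkGs : (k : ℝ) * Gs ≤ 24 * Real.log X ^ ((4 : ℝ) / 5) * MaynardDense.gam k := by
    calc (k : ℝ) * Gs ≤ (k : ℝ) * (3 * ((k : ℝ) * Real.log k) ^ 2 * MaynardDense.gam k) :=
          mul_le_mul_of_nonneg_left hGsb hk0.le
      _ = 3 * ((k : ℝ) ^ 3 * Real.log k ^ 2) * MaynardDense.gam k := by ring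
      _ ≤ 3 * (8 * Real.log X ^ ((4 : ℝ) / 5)) * MaynardDense.gam k :=
          mul_le_mul_of_nonneg_right (mul_le_mul_of_nonneg_left hk3X (by norm_num)) hG7.le
      _ = 24 * Real.log X ^ ((4 : ℝ) / 5) * MaynardDense.gam k := by ring
  have huv : u * Real.log X ^ ((4 : ℝ) / 5) = Real.log X / u := by
    rw [eq_div_iff hu0.ne', hu, ← Real.rpow_add hlX0, ← Real.rpow_add hlX0]
    norm_num
  have hkε : (k : ℝ) * (C84 * Λ * Gs / (MaynardDense.gam k * Real.log R)) ≤ CE / u := by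
    have hden : 0 < MaynardDense.gam k * Real.log R := mul_pos hG7 hlogR
    rw [show (k : ℝ) * (C84 * Λ * Gs / (MaynardDense.gam k * Real.log R)) =
      C84 * Λ * ((k : ℝ) * Gs) / (MaynardDense.gam k * Real.log R) by ring]
    rw [div_le_iff₀ hden]
    calc C84 * Λ * ((k : ℝ) * Gs) ≤ C84 * Λ * (24 * Real.log X ^ ((4 : ℝ) / 5) * MaynardDense.gam k) :=
          mul_le_mul_of_nonneg_left hkGs (by positivity)
      _ = 24 * 29 * C84 * (u * Real.log X ^ ((4 : ℝ) / 5)) * MaynardDense.gam k := by rw [hΛ]; ring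
      _ = 24 * 29 * C84 * (Real.log X / u) * MaynardDense.gam k := by rw [huv]
      _ = CE / u * (MaynardDense.gam k * (Real.log X / 30)) := by rw [hCE]; ring
      _ ≤ CE / u * (MaynardDense.gam k * Real.log R) := by
          apply mul_le_mul_of_nonneg_left _ (by positivity)
          exact mul_le_mul_of_nonneg_left (by linarith) hG7.le
  have hkε1 : (k : ℝ) * (C84 * Λ * Gs / (MaynardDense.gam k * Real.log R)) ≤ 1 := by
    refine hkε.trans ?_
    rw [div_le_one hu0]
    linarith
  have h := h84 k (idxMod L B R) k (2 * (k : ℝ) - 1) A (fun t => MaynardDense.profExt k t ^ 2)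
    (fun x => MaynardDense.psi x ^ 2) Gs (MaynardDense.gam k) 1 60 Λ R 0 (by exact_mod_cast hk2)
    (by nlinarith [sq_nonneg ((k : ℝ) - 1)]) (fun i => idxMod_ne_zero L hB0 R i)
    (fun i p hp hle => dvd_idxMod_of_real_le L B R i hp hle) (fun p hp => sub_omegaL_pos hadm hp)
    (fun p hp => abs_dev_omegaL_add_le hk2 hadm hp) hG1 hG2 hG3 hG4 hG5 hG6 hG7 hΦ1 hΦ2 hΦ3 hR2'
    hΛhyp hkε1
  obtain ⟨hPi0, hbd⟩ := h
  rw [MaynardDense.orthInt_profExt_sq_psi_sq hk2] at hbd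
  -- `γ^k ≤ 2 I_k(F)`
  have hgamIF : MaynardDense.gam k ^ k ≤ 2 * MaynardDense.IF k := by
    have := MaynardDense.orthantI_F_ge_half hCk
    rw [MaynardDense.IF]; linarith
  -- `|S − Π LI| ≤ 244 kε Π LI`
  set kε : ℝ := (k : ℝ) * (C84 * Λ * Gs / (MaynardDense.gam k * Real.log R)) with hkεdef
  have hkε0 : 0 ≤ kε := by
    rw [hkεdef]
    have hGs0 : 0 ≤ Gs := le_trans (by positivity) (hG5 0 ⟨le_rfl, zero_le_one⟩)
    positivity
  have hS1 : |S - Pi * LI| ≤ 244 * kε * (Pi * LI) := by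
    have h1 : |S - Pi * LI| ≤ 2 * kε * (Pi * Real.log R ^ k * MaynardDense.gam k ^ k * (1 + 60)) := by
      rw [hLI, ← mul_assoc]; exact hbd
    refine h1.trans ?_
    have h2 : Pi * Real.log R ^ k * MaynardDense.gam k ^ k ≤ Pi * Real.log R ^ k * (2 * MaynardDense.IF k) :=
      mul_le_mul_of_nonneg_left hgamIF (by positivity)
    calc 2 * kε * (Pi * Real.log R ^ k * MaynardDense.gam k ^ k * (1 + 60))
        ≤ 2 * kε * (Pi * Real.log R ^ k * (2 * MaynardDense.IF k) * (1 + 60)) := by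
          apply mul_le_mul_of_nonneg_left _ (by positivity)
          exact mul_le_mul_of_nonneg_right h2 (by norm_num)
      _ = 244 * kε * (Pi * LI) := by rw [hLI]; ring
  -- `P · Π = excProd ∈ [1, 1 + 1/log X]`
  have hPPi : P * Pi = ex := hPiE
  -- `|P S − LI| ≤ (488 kε + 1/log X) LI`
  have hS2 : |P * S - LI| ≤ (488 * kε + 1 / Real.log X) * LI := by
    have hsplit : P * S - LI = P * (S - Pi * LI) + (ex - 1) * LI := by rw [← hPPi]; ring
    rw [hsplit]
    have hex0 : 0 ≤ ex - 1 := by linarith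
    have hexle : ex ≤ 2 := by
      have : 1 / Real.log X ≤ 1 := by rw [div_le_one hlX0]; exact hlX1
      linarith
    calc |P * (S - Pi * LI) + (ex - 1) * LI| ≤ |P * (S - Pi * LI)| + |(ex - 1) * LI| := abs_add_le _ _
      _ = P * |S - Pi * LI| + (ex - 1) * LI := by
          rw [abs_mul, abs_of_pos hP0, abs_mul, abs_of_nonneg hex0, abs_of_nonneg hLI0]
      _ ≤ P * (244 * kε * (Pi * LI)) + (ex - 1) * LI := by gcongr
      _ = 244 * kε * ex * LI + (ex - 1) * LI := by rw [← hPPi]; ring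
      _ ≤ 244 * kε * 2 * LI + (1 / Real.log X) * LI := by
          gcongr
          · linarith
      _ = (488 * kε + 1 / Real.log X) * LI := by ring
  -- assemble
  have hgoal : |c * (P ^ 2 * S) - mainTermA L B X R (MaynardDense.IF k)| ≤
      (488 * CE + 1) / u * mainTermA L B X R (MaynardDense.IF k) := by
    rw [hmain]
    have hsplit : c * (P ^ 2 * S) - c * P * LI = c * P * (P * S - LI) := by ring
    rw [hsplit, abs_mul, abs_of_nonneg (mul_nonneg hc0 hP0.le)]
    have hcP : 0 ≤ c * P := mul_nonneg hc0 hP0.le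
    calc c * P * |P * S - LI| ≤ c * P * ((488 * kε + 1 / Real.log X) * LI) :=
          mul_le_mul_of_nonneg_left hS2 hcP
      _ = (488 * kε + 1 / Real.log X) * (c * P * LI) := by ring
      _ ≤ ((488 * CE + 1) / u) * (c * P * LI) := by
          apply mul_le_mul_of_nonneg_right _ (by positivity)
          rw [add_div]
          have h1 : 1 / Real.log X ≤ 1 / u := one_div_le_one_div_of_le hu0 hulX
          have h2 : 488 * kε ≤ 488 * CE / u := by rw [mul_div_assoc]; exact mul_le_mul_of_nonneg_left hkε (by norm_num)
          linarith
  exact hgoal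

end Literature.NumberTheory.Sieve.FGKMT2018
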